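/-
Copyright (c) 2026. All rights reserved.
Released under Apache 2.0 license as described in the file LICENSE.
-/
import Summits.Langlands.Langlands.Theorems.SoloInformedTateFamilyLGCAway
import Mathlib.RepresentationTheory.Irreducible
import HarnessLib

/-!
# Rigidity of the local components of `π_θ` on `GL₁`, and the summit's statement on the Tate family
# as the value of the pinned `D_pst` (rung Λ20)

Programme `solo-Langlands-informed` (statement analysis of `Summit.Langlands`).  Rung Λ19
(`SoloInformedTateFamilyLGCAway`) proved local–global compatibility of the Tate pair `(π_{‖·‖^k}, χ_ℓ^k)`
at every `v ∤ ℓ` and reduced the summit's (A)-existence statement at `π_{‖·‖^k}` to the `v ∣ ℓ` clauses,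
each implied by its `p`-adic Hodge conjunct.  This file closes the analysis by an `iff`:

* §1 ★★ **Flath rigidity on `GL₁`** (`irrClass_eq_ofQuasiChar_of_hasLocalComponentAt`): for the Borel–Jacquet
  datum `π_θ = ℂ·(θ∘det)/⊥` of ANY Hecke character `θ`, EVERY local component `πᵥ` at `v` (any irreducible
  smooth `πᵥ` with a non-zero `GL₁(K_v)`-map to `W/W'` — the summit's `HasLocalComponentAt`) is isomorphic to
  `θ_v ∘ det`: the coordinate `λ = ev₁ ∘ f` of such a map `f : πᵥ → ℂ·(θ∘det)` is a non-zero intertwiner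
  `πᵥ → (θ_v ∘ det)`, bijective by Schur (Mathlib `Representation.IsIrreducible.bijective_or_eq_zero`).
* §2 ★★ (`localGlobalCompatibleAt_line_iff`) hence for EVERY reciprocity datum `𝓡`, `ι`, `ρ`, `v`, the summit's
  clause `LocalGlobalCompatibleAt 𝓡 ι π_θ ρ v` is EQUIVALENT to its Galois half with the explicit target class
  `[(θ_v ∘ Art_v, N = 0)]` (`rec₁` computed in Λ19 `recGL_one_ofQuasiChar`): the automorphic side of the typed
  summit carries no further information on the line data of `GL₁`.
* §3 ★★★ (`exists_corresponds_normPow_iff_pst`) on the Tate family, for every `𝓡`, `ι : ℚ̄_ℓ ≃ ℂ`, `k`: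
  `(∃ ρ, IsGeometricFramed 𝓡 ρ ∧ Corresponds 𝓡 ι π_{‖·‖^k} ρ) ↔ ∀ v ∣ ℓ, ∃ r rℂ,
  (𝓡.pst ℓ v hv).IsWeilDeligneOf (χ_ℓ^k|Γ_{K_v}) r ∧ r ~ι rℂ ∧ rℂ^{F-ss} ∈ [(‖·‖_v^k ∘ Art_v, 0)]`.
  The typed summit's (A)-statement at `π_{‖·‖^k}` IS the statement that the Weil–Deligne functor of the PINNED
  datum `fontainePstAdicCompletion v ℓ hv` takes the value `(‖·‖_v^k ∘ Art_v, 0) = (w ↦ q_v^{k·deg w}, 0)` (up to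
  Frobenius-semisimplification and `ι`) on the infinitely ramified character `χ_ℓ^k|Γ_{K_v}` at every `v ∣ ℓ` —
  Fontaine's theorem `WD(D_pst(χ_ℓ^k)) = (|·|^{-k}-twist …)` for THE `B_dR`, and an unproved (and, by the s58
  analysis, undetermined) property of the `Classical.epsilon`-chosen datum of the tree.

No new definitions.

References: Flath, *Decomposition of representations into tensor products*, Proc. Sympos. Pure Math. 33
(1979), part 1, Thm. 2–3; Bushnell–Henniart, Grundlehren 335 (2006), §1.1, §2.6 (Schur); Tate, *Number
theoretic background* (1979), (4.1.3); Buzzard–Gee, LMS LNS 414 (2014), Conj. 3.2.2; Fontaine, Astérisque 223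
(1994), Exp. VIII §2.3.7.
-/

noncomputable section

open scoped MatrixGroups Matrix Classical NumberField
open NumberField IsDedekindDomain Field Filter
open Literature.NumberTheory.Automorphic Literature.NumberTheory.GaloisRepresentations

namespace Summit.Langlands.Langlands.Theorems

namespace GLOneRigidity

variable {K : Type} [Field K] [NumberField K]

/-! ### §1 Flath rigidity on `GL₁`: every local component of `π_θ` at `v` is `θ_v ∘ det` -/

section Rigidity

variable {hcpt : isCompact_glFiniteIntegralLevel 1 K}

/-- ★★ **Every local component of `π_θ = ℂ·(θ∘det)/⊥` at `v` is isomorphic to `θ_v ∘ det`.**  If an irreducible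
smooth `πᵥ` of `GL₁(K_v)` admits a `GL₁(K_v)`-map `f : πᵥ → W = ℂ·(θ∘det)`, non-zero modulo `W' = ⊥`, then the
coordinate `λ = ev₁ ∘ f` (`f x = λ(x)·(θ∘det)` since `(θ∘det)(1) = 1`) satisfies
`λ(πᵥ(g)x) = θ_v(det g)·λ(x)` (`(θ∘det)(ι_v g) = θ_v(det g)`, `detTwist_ofLocal`), i.e. is a non-zero intertwiner
`πᵥ → (θ_v∘det)`; by Schur's lemma for the two irreducibles it is bijective, so `[πᵥ] = [θ_v ∘ det]` in `Irr(GL₁(K_v))`.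
[cite: Flath1979, Thm. 3] [cite: BushnellHenniart2006, §1.1 and §2.6] -/
theorem irrClass_eq_ofQuasiChar_of_hasLocalComponentAt (θ : HeckeCharacter K)
    {π : AutomorphicRepData (AutomorphyDatum.gl 1 K hcpt)}
    (hW : π.W = Submodule.span ℂ {fun g : (AdelicGroupData.gl 1 K).Adelic => (detTwist 1 θ g : ℂ)})
    (hW' : π.W' = ⊥) {v : HeightOneSpectrum (𝓞 K)} {πv : SmoothIrrep (GL (Fin 1) (v.adicCompletion K))}
    (h : π.HasLocalComponentAt v πv.ρ) :
    IrrClass.mk πv =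
      IrrClass.mk (SmoothIrrep.ofQuasiChar
        (⟨θ.localComponent v, θ.continuous_localComponent v⟩ : QuasiChar (v.adicCompletion K))) := by
  obtain ⟨f, hfW, hfW', hf⟩ := h
  set φ : (AdelicGroupData.gl 1 K).Adelic → ℂ := fun g => (detTwist 1 θ g : ℂ) with hφ
  have hφ1 : φ 1 = 1 := by
    show ((detTwist 1 θ 1 : ℂˣ) : ℂ) = 1
    rw [map_one, Units.val_one]
  -- the coordinate `λ = ev₁ ∘ f` on the line `ℂ·φ`
  set lam : πv.V →ₗ[ℂ] ℂ := (LinearMap.proj (1 : (AdelicGroupData.gl 1 K).Adelic)).comp f with hlam_def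
  have hlam_apply : ∀ x, lam x = f x 1 := fun x => rfl
  have hfx : ∀ x, f x = lam x • φ := by
    intro x
    have hx : f x ∈ π.W := hfW (LinearMap.mem_range_self f x)
    rw [hW, Submodule.mem_span_singleton] at hx
    obtain ⟨c, hc⟩ := hx
    have hc' : lam x = c := by
      rw [hlam_apply, ← hc, Pi.smul_apply, hφ1, smul_eq_mul, mul_one]
    rw [hc', hc]
  -- `λ` intertwines `πᵥ` with the character `θ_v ∘ det` on `ℂ`
  have hlam : ∀ (g : GL (Fin 1) (v.adicCompletion K)) (x : πv.V),
      lam (πv.ρ g x) = glOneRep (θ.localComponent v) g (lam x) := by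
    intro g x
    have h1 := hf g x
    rw [hW', Submodule.mem_bot, sub_eq_zero] at h1
    have h2 := congr_fun h1 1
    rw [rightTranslation_apply, one_mul, hfx x, Pi.smul_apply, smul_eq_mul] at h2
    rw [hlam_apply (πv.ρ g x), h2, glOneRep_apply, mul_comm (lam x)]
    congr 1
    show ((detTwist 1 θ (GLn.ofLocal 1 K v g) : ℂˣ) : ℂ) = _
    rw [detTwist_ofLocal]
  haveI : (glOneRep (θ.localComponent v)).IsIrreducible := isIrreducible_glOneRep _
  -- Schur: a non-zero intertwiner between irreducibles is bijective
  let F : Representation.IntertwiningMap πv.ρ (glOneRep (θ.localComponent v)) :=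
    LinearMap.intertwiningMap_of_isIntertwiningMap πv.ρ (glOneRep (θ.localComponent v)) lam hlam
  rcases Representation.IsIrreducible.bijective_or_eq_zero F with hbij | h0
  · exact IrrClass.mk_eq_mk_of_equiv (F.ofBijective hbij)
  · exfalso
    apply hfW'
    rw [hW']
    rintro _ ⟨x, rfl⟩
    have hx : lam x = 0 := by
      have h0x := DFunLike.congr_fun h0 x
      rw [Representation.IntertwiningMap.coe_zero, Pi.zero_apply] at h0x
      exact h0x
    rw [hfx x, hx, zero_smul]
    exact Submodule.zero_mem _

end Rigidity

/-! ### §2 The clause on the line data of `GL₁` is its Galois half -/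

section Line

variable {hcpt : isCompact_glFiniteIntegralLevel 1 K} {ℓ : ℕ} [Fact ℓ.Prime]

/-- ★★ **`LocalGlobalCompatibleAt` on `π_θ` is its Galois half.**  For every reciprocity datum `𝓡`, every
`ι : ℚ̄_ℓ ≃ ℂ`, every Hecke character `θ`, every `ρ : Γ_K → GL₁(ℚ̄_ℓ)` and every finite `v`:
`LocalGlobalCompatibleAt 𝓡 ι π_θ ρ v ↔ ∃ r rℂ, (v ∤ ℓ → r = WD_ℓ(ρ|W_{K_v})) ∧ (v ∣ ℓ → (𝓡.pst ℓ v).IsWeilDeligneOf ρ|Γ_{K_v} r)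
∧ r ~ι rℂ ∧ rℂ^{F-ss} ∈ [(θ_v ∘ Art_v, 0)]` — every local component of `π_θ` is `θ_v ∘ det` (§1) and `rec₁` of
every `𝓡` sends it to `[(θ_v ∘ Art_v, 0)]` (Λ19 `recGL_one_ofQuasiChar`).
[cite: Flath1979, Thm. 3] [cite: HarrisTaylorAMS2001, Thm. A (i)] [cite: BuzzardGeeLMS2014, Conj. 3.2.2] -/
theorem localGlobalCompatibleAt_line_iff (𝓡 : ReciprocityData K) (ι : PadicAlgCl ℓ ≃+* ℂ) (θ : HeckeCharacter K)
    {π : AutomorphicRepData (AutomorphyDatum.gl 1 K hcpt)}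
    (hW : π.W = Submodule.span ℂ {fun g : (AdelicGroupData.gl 1 K).Adelic => (detTwist 1 θ g : ℂ)})
    (hW' : π.W' = ⊥) (ρ : FramedGaloisRep K (PadicAlgCl ℓ) 1) (v : HeightOneSpectrum (𝓞 K)) :
    LocalGlobalCompatibleAt 𝓡 ι π ρ v ↔
      ∃ (r : WeilDeligneRep (v.adicCompletion K) (PadicAlgCl ℓ) (Fin 1 → PadicAlgCl ℓ))
        (rℂ : WeilDeligneRep (v.adicCompletion K) ℂ (Fin 1 → ℂ)),
        (((ℓ : ℕ) : 𝓞 K) ∉ v.asIdeal →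
            IsWeilDeligneOfLadic (FramedGaloisRep.toLocal v ρ).toWeilGroupHom r) ∧
          (∀ hv : ((ℓ : ℕ) : 𝓞 K) ∈ v.asIdeal, (𝓡.pst ℓ v hv).IsWeilDeligneOf (FramedGaloisRep.toLocal v ρ) r) ∧
          r.IsTransportAlong (ι : PadicAlgCl ℓ →+* ℂ) rℂ ∧
          rℂ.HasFrobSemisimpleClass
            (Quotient.mk _ ⟨WeilDeligneRep.ofQuasiCharOn (Fin 1 → ℂ) (𝓡.llc v).hns (𝓡.llc v).artin
                (⟨θ.localComponent v, θ.continuous_localComponent v⟩ : QuasiChar (v.adicCompletion K)),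
              WeilDeligneRep.isFrobSemisimple_ofQuasiCharOn (𝓡.llc v).hns (𝓡.llc v).artin _⟩) := by
  constructor
  · rintro ⟨πv, r, rℂ, hπv, h₁, h₂, h₃, h₄⟩
    rw [irrClass_eq_ofQuasiChar_of_hasLocalComponentAt θ hW hW' hπv, recGL_one_ofQuasiChar] at h₄
    exact ⟨r, rℂ, h₁, h₂, h₃, h₄⟩
  · rintro ⟨r, rℂ, h₁, h₂, h₃, h₄⟩
    refine ⟨SmoothIrrep.ofQuasiChar
        (⟨θ.localComponent v, θ.continuous_localComponent v⟩ : QuasiChar (v.adicCompletion K)),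
      r, rℂ, hasLocalComponentAt_ofQuasiChar_localComponent θ hW hW' v, h₁, h₂, h₃, ?_⟩
    rw [recGL_one_ofQuasiChar]
    exact h₄

end Line

/-! ### §3 The summit's (A)-statement on the Tate family is the value of the pinned `D_pst` -/

section NormPow

variable {hcpt : isCompact_glFiniteIntegralLevel 1 K} {ℓ : ℕ} [Fact ℓ.Prime]

/-- ★★ **At `v ∣ ℓ` the clause on the Tate pair is exactly its pinned `p`-adic Hodge conjunct**:
`LocalGlobalCompatibleAt 𝓡 ι π_{‖·‖^k} χ_ℓ^k v ↔ ∃ r rℂ, (𝓡.pst ℓ v hv).IsWeilDeligneOf (χ_ℓ^k|Γ_{K_v}) r ∧ r ~ι rℂ ∧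
rℂ^{F-ss} ∈ [(‖·‖_v^k ∘ Art_v, 0)]` (§2 with the `v ∤ ℓ` conjunct vacuous).
[cite: BuzzardGeeLMS2014, Conj. 3.2.2] [cite: FontaineAsterisque223VIII, Exp. VIII §2.3.7] -/
theorem localGlobalCompatibleAt_normPow_above_iff (𝓡 : ReciprocityData K) (ι : PadicAlgCl ℓ ≃+* ℂ) (k : ℕ)
    {π : AutomorphicRepData (AutomorphyDatum.gl 1 K hcpt)}
    (hW : π.W = Submodule.span ℂ
      {fun g : (AdelicGroupData.gl 1 K).Adelic => (detTwist 1 (HeckeCharacter.normCharacter K ^ k) g : ℂ)})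
    (hW' : π.W' = ⊥) {v : HeightOneSpectrum (𝓞 K)} (hv : ((ℓ : ℕ) : 𝓞 K) ∈ v.asIdeal) :
    LocalGlobalCompatibleAt 𝓡 ι π
        (FramedRep.twist (1 : FramedGaloisRep K (PadicAlgCl ℓ) 1) (D2Cris.tateChar K ℓ k)) v ↔
      ∃ (r : WeilDeligneRep (v.adicCompletion K) (PadicAlgCl ℓ) (Fin 1 → PadicAlgCl ℓ))
        (rℂ : WeilDeligneRep (v.adicCompletion K) ℂ (Fin 1 → ℂ)),
        (𝓡.pst ℓ v hv).IsWeilDeligneOf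
            (FramedGaloisRep.toLocal v
              (FramedRep.twist (1 : FramedGaloisRep K (PadicAlgCl ℓ) 1) (D2Cris.tateChar K ℓ k))) r ∧
          r.IsTransportAlong (ι : PadicAlgCl ℓ →+* ℂ) rℂ ∧
          rℂ.HasFrobSemisimpleClass
            (Quotient.mk _ ⟨WeilDeligneRep.ofQuasiCharOn (Fin 1 → ℂ) (𝓡.llc v).hns (𝓡.llc v).artin
                (⟨(HeckeCharacter.normCharacter K ^ k).localComponent v,
                  (HeckeCharacter.normCharacter K ^ k).continuous_localComponent v⟩ :
                    QuasiChar (v.adicCompletion K)),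
              WeilDeligneRep.isFrobSemisimple_ofQuasiCharOn (𝓡.llc v).hns (𝓡.llc v).artin _⟩) := by
  rw [localGlobalCompatibleAt_line_iff 𝓡 ι (HeckeCharacter.normCharacter K ^ k) hW hW']
  refine ⟨fun ⟨r, rℂ, _, h₂, h₃, h₄⟩ => ⟨r, rℂ, h₂ hv, h₃, h₄⟩,
    fun ⟨r, rℂ, h₂, h₃, h₄⟩ => ⟨r, rℂ, fun hv' => absurd hv hv', fun _ => h₂, h₃, h₄⟩⟩

/-- ★★★ **The typed summit's (A)-statement on the Tate family IS the value of the pinned `WD ∘ D_pst` on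
`χ_ℓ^k`.**  For every reciprocity datum `𝓡`, every `ι : ℚ̄_ℓ ≃ ℂ` and every `k : ℕ`:
`(∃ ρ, IsGeometricFramed 𝓡 ρ ∧ Corresponds 𝓡 ι π_{‖·‖^k} ρ) ↔ ∀ v ∣ ℓ, ∃ r rℂ,
(𝓡.pst ℓ v hv).IsWeilDeligneOf (χ_ℓ^k|Γ_{K_v}) r ∧ r ~ι rℂ ∧ rℂ^{F-ss} ∈ [(w ↦ q_v^{k·deg w}, N = 0)]`
(Λ19 `exists_corresponds_normPow_iff_above` and `localGlobalCompatibleAt_normPow_above_iff`; the target class is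
`(‖·‖_v^k ∘ Art_v, 0)`, `‖Art_v w‖_v^k = q_v^{k·deg w}` by Λ19 `localQuasiChar_normPow_artin`).  Every other
constituent of the summit at `π_{‖·‖^k}` — existence of `π`, L-algebraicity, geometricity of `χ_ℓ^k` for `𝓡.pst`,
the unramified clause, rigidity of the partner, compatibility at `v ∤ ℓ`, the local components and their `rec₁` —
is a theorem of the tree (rungs Λ15–Λ20).
[cite: BuzzardGeeLMS2014, Conj. 3.2.1 and Conj. 3.2.2] [cite: FontaineAsterisque223VIII, Exp. VIII §2.3.7]
[cite: TateCorvallis1979, (4.1.3)] -/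
theorem exists_corresponds_normPow_iff_pst (𝓡 : ReciprocityData K) (ι : PadicAlgCl ℓ ≃+* ℂ) (k : ℕ)
    {π : AutomorphicRepData (AutomorphyDatum.gl 1 K hcpt)}
    (hW : π.W = Submodule.span ℂ
      {fun g : (AdelicGroupData.gl 1 K).Adelic => (detTwist 1 (HeckeCharacter.normCharacter K ^ k) g : ℂ)})
    (hW' : π.W' = ⊥) :
    (∃ ρ : FramedGaloisRep K (PadicAlgCl ℓ) 1, IsGeometricFramed 𝓡 ρ ∧ Corresponds 𝓡 ι π ρ) ↔
      ∀ (v : HeightOneSpectrum (𝓞 K)) (hv : ((ℓ : ℕ) : 𝓞 K) ∈ v.asIdeal),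
        ∃ (r : WeilDeligneRep (v.adicCompletion K) (PadicAlgCl ℓ) (Fin 1 → PadicAlgCl ℓ))
          (rℂ : WeilDeligneRep (v.adicCompletion K) ℂ (Fin 1 → ℂ)),
          (𝓡.pst ℓ v hv).IsWeilDeligneOf
              (FramedGaloisRep.toLocal v
                (FramedRep.twist (1 : FramedGaloisRep K (PadicAlgCl ℓ) 1) (D2Cris.tateChar K ℓ k))) r ∧
            r.IsTransportAlong (ι : PadicAlgCl ℓ →+* ℂ) rℂ ∧
            rℂ.HasFrobSemisimpleClass
              (Quotient.mk _ ⟨WeilDeligneRep.ofQuasiCharOn (Fin 1 → ℂ) (𝓡.llc v).hns (𝓡.llc v).artin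
                  (⟨(HeckeCharacter.normCharacter K ^ k).localComponent v,
                    (HeckeCharacter.normCharacter K ^ k).continuous_localComponent v⟩ :
                      QuasiChar (v.adicCompletion K)),
                WeilDeligneRep.isFrobSemisimple_ofQuasiCharOn (𝓡.llc v).hns (𝓡.llc v).artin _⟩) := by
  rw [exists_corresponds_normPow_iff_above 𝓡 ι k hW hW']
  refine forall_congr' fun v => forall_congr' fun hv => ?_
  exact localGlobalCompatibleAt_normPow_above_iff 𝓡 ι k hW hW' hv

/-- ★★★ **The summit's direction (A) on `GL₁`, read on the Tate family.**  `AutomorphicToGalois 1 𝓡 hcpt` implies,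
for every `ℓ`, `ι`, `k` and every `v ∣ ℓ`, that the PINNED datum attaches to `χ_ℓ^k|Γ_{K_v}` a Weil–Deligne
representation whose `ι`-transport has Frobenius-semisimple class `[(w ↦ q_v^{k·deg w}, N = 0)]`.
[cite: BuzzardGeeLMS2014, Conj. 3.2.1] [cite: FontaineAsterisque223VIII, Exp. VIII §2.3.7] -/
theorem pst_tateChar_of_automorphicToGalois (𝓡 : ReciprocityData K) (hA : AutomorphicToGalois 1 𝓡 hcpt)
    (ι : PadicAlgCl ℓ ≃+* ℂ) (k : ℕ) {v : HeightOneSpectrum (𝓞 K)} (hv : ((ℓ : ℕ) : 𝓞 K) ∈ v.asIdeal) :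
    ∃ (r : WeilDeligneRep (v.adicCompletion K) (PadicAlgCl ℓ) (Fin 1 → PadicAlgCl ℓ))
      (rℂ : WeilDeligneRep (v.adicCompletion K) ℂ (Fin 1 → ℂ)),
      (𝓡.pst ℓ v hv).IsWeilDeligneOf
          (FramedGaloisRep.toLocal v
            (FramedRep.twist (1 : FramedGaloisRep K (PadicAlgCl ℓ) 1) (D2Cris.tateChar K ℓ k))) r ∧
        r.IsTransportAlong (ι : PadicAlgCl ℓ →+* ℂ) rℂ ∧
        rℂ.HasFrobSemisimpleClass
          (Quotient.mk _ ⟨WeilDeligneRep.ofQuasiCharOn (Fin 1 → ℂ) (𝓡.llc v).hns (𝓡.llc v).artin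
              (⟨(HeckeCharacter.normCharacter K ^ k).localComponent v,
                (HeckeCharacter.normCharacter K ^ k).continuous_localComponent v⟩ :
                  QuasiChar (v.adicCompletion K)),
            WeilDeligneRep.isFrobSemisimple_ofQuasiCharOn (𝓡.llc v).hns (𝓡.llc v).artin _⟩) := by
  obtain ⟨π, hW, hW', hLGC⟩ := localGlobalCompatibleAt_normPow_of_automorphicToGalois 𝓡 hA ι k
  exact (localGlobalCompatibleAt_normPow_above_iff 𝓡 ι k hW hW' hv).mp (hLGC v)

end NormPow

end GLOneRigidity

end Summit.Langlands.Langlands.Theorems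

end
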